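import Mathlib.Analysis.Calculus.ImplicitContDiff
import Literature.NumberTheory.Transcendental.SemialgebraicMapsSmoothProofs

/-!
# `SectorToKernel` (stmt-KontsevichZagierPeriods-10813), line `effective-cube-surjection`:
# stub A `stub_saAnalyticOffSmall` — semialgebraic functions are analytic off a small set

A real function `f` whose graph over `s ⊆ ℝᵐ` is `k`-semialgebraic is real ANALYTIC off a
`k`-semialgebraic subset `Z ⊆ s` with empty interior, `s \ Z` being open
(`exists_analyticOnNhd_of_isSemialgebraicFunOn`; the registered stub `stub_saAnalyticOffSmall` is
the case `k = ℚ`).  This is the tree's `IsSemialgebraicFunOn.exists_contDiffOn_holds`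
(`Literature/NumberTheory/Transcendental/SemialgebraicMapsSmoothProofs.lean`, conclusion
`ContDiffOn ℝ ∞ f (s \ Z)`) run at smoothness `ω` instead of `∞`.  The proof is copied from that
file, every lemma there not mentioning `∞` being reused by name:

1. every graph point `(f x, x)` is a zero of a member of a finite family `Q₀` of polynomials over
   `k`, none vanishing identically
   (`IsSemialgebraicFunOn.exists_finset_forall_exists_aeval_cons_eq_zero`);
2. the Thom pieces `M(q, e, τ) ⊆ s` (degree of `q(x, ·)` exactly `e`, signs of the `y`-derivatives
   at `f x` prescribed by `τ`, `τ 0 = 0`) are semialgebraic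
   (`IsSemialgebraicFunOn.isSemialgebraic_piece`);
3. on the interior of a piece, `f` is continuous (`continuousAt_of_thom_signs`, Thom's lemma) and
   `f x` is a simple root of a `y`-derivative `∂ʳ⁻¹q(x, ·)`, a polynomial — hence analytic —
   equation, so `f` is `C^ω` there by Mathlib's implicit function theorem
   `ContDiffAt.implicitFunction` at `n = ω`, and `C^ω = analytic` (`ContDiffAt.analyticAt`):
   `contDiffAt_omega_of_simple_root`, `analyticAt_of_mem_interior_piece` below, the only new steps;
4. `Z = s \ ⋃ interior M(q, e, τ)` is semialgebraic with empty interior (covered by the proper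
   algebraic sets `{x | q(x, ·) = 0}` and the nowhere dense sets `M \ interior M`).

References: J. Bochnak, M. Coste, M.-F. Roy, *Real Algebraic Geometry* (1998), Prop. 2.9.10,
Prop. 8.1.8, Thm. 9.1.8; S. Basu, R. Pollack, M.-F. Roy, *Algorithms in Real Algebraic Geometry*,
2nd ed. (2006), Lemma 5.33 (Thom's lemma), Thm. 3.25 (implicit function theorem).
-/

noncomputable section

namespace Summit.KontsevichZagierPeriods.FurushoPentagon.SectorToKernel

open Set Filter MvPolynomial Polynomial
open scoped Topology ContDiff
open Literature.ModelTheory.ExponentialFields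
open Literature.NumberTheory.Transcendental

variable {k : Type*} [CommRing k] [Algebra k ℝ] {m : ℕ}

/-! ## The analytic implicit function theorem at a continuous simple root -/

/-- The map `(x, y) ↦ (y, x) : ℝᵐ × ℝ → ℝ¹⁺ᵐ` (`Fin.cons`) is `C^ω`. [folklore] -/
theorem contDiff_cons_omega :
    ContDiff ℝ ω fun z : (Fin m → ℝ) × ℝ => (Fin.cons z.2 z.1 : Fin (m + 1) → ℝ) := by
  refine contDiff_pi.mpr fun i => ?_
  refine Fin.cases ?_ (fun j => ?_) i
  · simpa using contDiff_snd
  · have h := (contDiff_apply (n := ω) ℝ ℝ j).comp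
      (contDiff_fst (𝕜 := ℝ) (E := Fin m → ℝ) (F := ℝ))
    simp only [Fin.cons_succ]
    exact h

/-- Polynomial functions on `ℝ¹⁺ᵐ` composed with `(x, y) ↦ (y, x)` are `C^ω`. [folklore] -/
theorem contDiff_aeval_cons_omega (Q : MvPolynomial (Fin (m + 1)) k) :
    ContDiff ℝ ω fun z : (Fin m → ℝ) × ℝ => aeval (Fin.cons z.2 z.1 : Fin (m + 1) → ℝ) Q :=
  (analyticOnNhd_aeval Q).contDiff.comp contDiff_cons_omega

/-- **A continuous simple root of an analytic equation is analytic.** If `F : ℝᵐ × ℝ → ℝ` is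
`C^ω`, `U` is open, `f` is continuous on `U` and for every `x ∈ U` the value `f x` is a simple zero
of `F (x, ·)`, then `f` is `C^ω` at every point of `U`: by the implicit function theorem (Mathlib's
`ContDiffAt.implicitFunction` at `n = ω`) the zeros of `F` near `(x₀, f x₀)` form the graph of a
`C^ω` function `ψ`, and `f = ψ` near `x₀` by continuity.
[cite: BasuPollackRoy2006, Thm. 3.25 (implicit function theorem)] -/
theorem contDiffAt_omega_of_simple_root {U : Set (Fin m → ℝ)} (hU : IsOpen U)
    {f : (Fin m → ℝ) → ℝ} (F : (Fin m → ℝ) × ℝ → ℝ) (hF : ContDiff ℝ ω F)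
    (hroot : ∀ x ∈ U, F (x, f x) = 0)
    (hder : ∀ x ∈ U, deriv (fun y => F (x, y)) (f x) ≠ 0)
    (hcont : ∀ x ∈ U, ContinuousAt f x) {x₀ : Fin m → ℝ} (hx₀ : x₀ ∈ U) :
    ContDiffAt ℝ ω f x₀ := by
  -- adapted from `Literature.NumberTheory.Transcendental.contDiffAt_of_simple_root` (`∞ ↦ ω`)
  have cdf : ContDiffAt ℝ ω F (x₀, f x₀) := hF.contDiffAt
  have pn : (ω : ℕ∞ω) ≠ 0 := by simp
  -- the partial derivative in `y` at `(x₀, f x₀)` is `deriv (F (x₀, ·)) (f x₀) ≠ 0`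
  set c : ℝ := fderiv ℝ F (x₀, f x₀) ((0 : Fin m → ℝ), (1 : ℝ)) with hc
  have hcd : deriv (fun y => F (x₀, y)) (f x₀) = c := by
    have h1 : HasFDerivAt F (fderiv ℝ F (x₀, f x₀)) (x₀, f x₀) :=
      (cdf.differentiableAt pn).hasFDerivAt
    have h2 : HasDerivAt (fun y : ℝ => ((x₀, y) : (Fin m → ℝ) × ℝ)) ((0 : Fin m → ℝ), (1 : ℝ))
        (f x₀) :=
      (hasDerivAt_const (f x₀) x₀).prodMk (hasDerivAt_id (f x₀))
    exact (h1.comp_hasDerivAt (f x₀) h2).deriv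
  have hc0 : c ≠ 0 := hcd ▸ hder x₀ hx₀
  have if₂ : (fderiv ℝ F (x₀, f x₀) ∘L ContinuousLinearMap.inr ℝ (Fin m → ℝ) ℝ).IsInvertible := by
    refine ContinuousLinearMap.IsInvertible.of_inverse (g := c⁻¹ • ContinuousLinearMap.id ℝ ℝ)
      ?_ ?_
    · apply ContinuousLinearMap.ext_ring
      have hsm : (((0 : Fin m → ℝ), c⁻¹) : (Fin m → ℝ) × ℝ) = c⁻¹ • ((0 : Fin m → ℝ), (1 : ℝ)) := by
        simp
      simp only [ContinuousLinearMap.comp_apply, smul_apply,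
        ContinuousLinearMap.id_apply, smul_eq_mul, mul_one, ContinuousLinearMap.inr_apply]
      rw [hsm, ContinuousLinearMap.map_smul, smul_eq_mul, ← hc, inv_mul_cancel₀ hc0]
    · apply ContinuousLinearMap.ext_ring
      simp only [ContinuousLinearMap.comp_apply, smul_apply,
        ContinuousLinearMap.id_apply, smul_eq_mul, ContinuousLinearMap.inr_apply]
      rw [← hc, inv_mul_cancel₀ hc0]
  have hev := cdf.eventually_apply_eq_iff_implicitFunction pn if₂
  have hψ := cdf.contDiffAt_implicitFunction pn if₂
  -- `f` agrees with the implicit function near `x₀`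
  have hγ : Tendsto (fun x => (x, f x)) (𝓝 x₀) (𝓝 (x₀, f x₀)) :=
    continuousAt_id.prodMk (hcont x₀ hx₀)
  have heq : f =ᶠ[𝓝 x₀] cdf.implicitFunction pn if₂ := by
    filter_upwards [hγ.eventually hev, hU.mem_nhds hx₀] with x hx hxU
    have h0 : F (x, f x) = F (x₀, f x₀) := by rw [hroot x hxU, hroot x₀ hx₀]
    exact (hx.mp h0).symm
  exact hψ.congr_of_eventuallyEq heq

/-! ## Analyticity on the interior of a Thom piece -/

/-- **`f` is analytic on the interior of each piece.** On the interior `U` of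
`{x | deg q(x, ·) = e ∧ ∀ j ≤ N, sign ∂ʲq(x, ·)(f x) = τ j}` with `τ 0 = 0`, the function `f` is
continuous (`continuousAt_of_thom_signs`) and `f x` is a simple root of `∂ʳ⁻¹q(x, ·)` for the
least `r ≥ 1` with `τ r ≠ 0`, hence `f` is `C^ω` (`contDiffAt_omega_of_simple_root`), i.e. real
analytic. [cite: BochnakCosteRoy1998, Prop. 8.1.8 and §2.9 (Prop. 2.9.10)] -/
theorem analyticAt_of_mem_interior_piece (q : MvPolynomial (Fin (m + 1)) k) {N : ℕ}
    (hN : (finSuccEquiv k m q).natDegree ≤ N) (e : Fin (N + 1)) {τ : Fin (N + 1) → SignType}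
    (hτ : τ 0 = 0) {f : (Fin m → ℝ) → ℝ} {x₀ : Fin m → ℝ}
    (hx₀ : x₀ ∈ interior {x : Fin m → ℝ |
      (aeval x ((finSuccEquiv k m q).coeff e) ≠ 0 ∧
          ∀ j : Fin (N + 1), (e : ℕ) < j → aeval x ((finSuccEquiv k m q).coeff j) = 0) ∧
        ∀ j : Fin (N + 1), SignType.sign (aeval (Fin.cons (f x) x : Fin (m + 1) → ℝ)
          ((finSuccEquiv k m).symm (derivative^[(j : ℕ)] (finSuccEquiv k m q)))) = τ j}) :
    AnalyticAt ℝ f x₀ := by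
  -- adapted from `Literature.NumberTheory.Transcendental.contDiffAt_of_mem_interior_piece`
  -- the open set `U` and the specialisations `P x = q(x, ·)`
  set U := interior {x : Fin m → ℝ |
      (aeval x ((finSuccEquiv k m q).coeff e) ≠ 0 ∧
          ∀ j : Fin (N + 1), (e : ℕ) < j → aeval x ((finSuccEquiv k m q).coeff j) = 0) ∧
        ∀ j : Fin (N + 1), SignType.sign (aeval (Fin.cons (f x) x : Fin (m + 1) → ℝ)
          ((finSuccEquiv k m).symm (derivative^[(j : ℕ)] (finSuccEquiv k m q)))) = τ j} with hU
  have hUo : IsOpen U := isOpen_interior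
  set P : (Fin m → ℝ) → ℝ[X] := fun x =>
    (finSuccEquiv k m q).map (MvPolynomial.eval₂Hom (algebraMap k ℝ) x) with hP
  have hcoefP : ∀ x i, (P x).coeff i = aeval x ((finSuccEquiv k m q).coeff i) := fun x i =>
    coeff_map_finSuccEquiv q x i
  have hmem : ∀ x ∈ U, x ∈ {x : Fin m → ℝ |
      (aeval x ((finSuccEquiv k m q).coeff e) ≠ 0 ∧
          ∀ j : Fin (N + 1), (e : ℕ) < j → aeval x ((finSuccEquiv k m q).coeff j) = 0) ∧
        ∀ j : Fin (N + 1), SignType.sign (aeval (Fin.cons (f x) x : Fin (m + 1) → ℝ)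
          ((finSuccEquiv k m).symm (derivative^[(j : ℕ)] (finSuccEquiv k m q)))) = τ j} :=
    fun x hx => interior_subset hx
  -- degree exactly `e`, non-vanishing
  have he : ∀ x ∈ U, (P x).natDegree = e := by
    intro x hx
    refine natDegree_eq_of_le_of_coeff_ne_zero (natDegree_le_iff_coeff_eq_zero.mpr fun j hj => ?_)
      (by rw [hcoefP]; exact (hmem x hx).1.1)
    by_cases hjN : j < N + 1
    · rw [hcoefP]
      exact (hmem x hx).1.2 ⟨j, hjN⟩ hj
    · exact coeff_eq_zero_of_natDegree_lt
        ((natDegree_map_le.trans hN).trans_lt (not_lt.mp hjN))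
  have hP0 : ∀ x ∈ U, P x ≠ 0 := by
    intro x hx h0
    have := (hmem x hx).1.1
    rw [← hcoefP, h0, Polynomial.coeff_zero] at this
    exact this rfl
  -- the Thom sign vector, extended by `0`
  set σ : ℕ → SignType := fun j => if h : j < N + 1 then τ ⟨j, h⟩ else 0 with hσ
  have hσ0 : σ 0 = 0 := by simp [hσ, hτ]
  have hsign : ∀ x ∈ U, ∀ j ≤ (e : ℕ),
      SignType.sign ((derivative^[j] (P x)).eval (f x)) = σ j := by
    intro x hx j hj
    have hjN : j < N + 1 := lt_of_le_of_lt hj e.2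
    have := (hmem x hx).2 ⟨j, hjN⟩
    rw [aeval_cons_symm_iterate_derivative] at this
    have hσj : σ j = τ ⟨j, hjN⟩ := dif_pos hjN
    rw [hσj, ← this]
  -- continuity on `U`
  have hcont : ∀ x ∈ U, ContinuousAt f x := fun x hx =>
    continuousAt_of_thom_signs hUo P (continuous_eval_iterate_derivative_map q)
      (continuous_coeff_map_finSuccEquiv q) he hP0 hσ0 hsign hx
  -- the least `r ≥ 1` with `σ r ≠ 0`
  have hex : ∃ j, 1 ≤ j ∧ j ≤ (e : ℕ) ∧ σ j ≠ 0 := by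
    have htop : SignType.sign ((derivative^[(e : ℕ)] (P x₀)).eval (f x₀)) ≠ 0 := by
      rw [eval_iterate_derivative_natDegree (he x₀ hx₀), Ne, sign_eq_zero_iff, mul_eq_zero,
        not_or]
      exact ⟨Nat.cast_ne_zero.mpr (Nat.factorial_ne_zero _),
        by rw [hcoefP]; exact (hmem x₀ hx₀).1.1⟩
    rw [hsign x₀ hx₀ e le_rfl] at htop
    refine ⟨e, Nat.one_le_iff_ne_zero.mpr fun h0 => ?_, le_rfl, htop⟩
    rw [h0, hσ0] at htop
    exact htop rfl
  classical
  obtain ⟨hr1, hre, hσr⟩ := Nat.find_spec hex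
  have hmin : ∀ j < Nat.find hex, ¬(1 ≤ j ∧ j ≤ (e : ℕ) ∧ σ j ≠ 0) := fun j hj =>
    Nat.find_min hex hj
  set r := Nat.find hex with hr
  have hσr1 : σ (r - 1) = 0 := by
    by_cases h1 : r = 1
    · rw [h1, Nat.sub_self, hσ0]
    · by_contra hne
      exact hmin (r - 1) (by omega) ⟨by omega, by omega, hne⟩
  -- `f x` is a simple root of the analytic equation `∂ʳ⁻¹q(x, ·) (y) = 0` on `U`
  set F : (Fin m → ℝ) × ℝ → ℝ := fun z => aeval (Fin.cons z.2 z.1 : Fin (m + 1) → ℝ)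
    ((finSuccEquiv k m).symm (derivative^[r - 1] (finSuccEquiv k m q))) with hF
  have hFs : ContDiff ℝ ω F := contDiff_aeval_cons_omega _
  have hroot : ∀ x ∈ U, F (x, f x) = 0 := by
    intro x hx
    have := hsign x hx (r - 1) (by omega)
    rw [hσr1, sign_eq_zero_iff] at this
    simpa only [hF, aeval_cons_symm_iterate_derivative] using this
  have hder : ∀ x ∈ U, deriv (fun y => F (x, y)) (f x) ≠ 0 := by
    intro x hx
    have := hsign x hx r hre
    have hr' : r - 1 + 1 = r := by omega
    simp only [hF]
    rw [deriv_aeval_cons_symm_iterate_derivative, hr']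
    intro h0
    rw [h0, sign_zero] at this
    exact hσr this.symm
  exact (contDiffAt_omega_of_simple_root hUo F hFs hroot hder hcont hx₀).analyticAt

/-! ## Assembly -/

/-- **Semialgebraic functions are analytic off a small semialgebraic set.** A real function with
`k`-semialgebraic graph over `s ⊆ ℝᵐ` is real analytic off a `k`-semialgebraic subset `Z ⊆ s`
with empty interior, `s \ Z` being open: `s \ Z` is the union of the interiors of the finitely
many Thom pieces `M(q, e, τ)` (on which `f` is a Thom-selected simple root of `∂ʳ⁻¹q(x, ·)`,
continuous by Thom's lemma and analytic by the analytic implicit function theorem), and `Z` is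
covered by the proper algebraic sets `{x | q(x, ·) = 0}` and the nowhere dense semialgebraic sets
`M \ interior M`.  (The tree's `IsSemialgebraicFunOn.exists_contDiffOn_holds` with `C^∞` upgraded
to analytic; no openness of `s` is needed.)
[cite: BochnakCosteRoy1998, §2.9 (Prop. 2.9.10) and Prop. 8.1.8] -/
theorem exists_analyticOnNhd_of_isSemialgebraicFunOn {s : Set (Fin m → ℝ)}
    {f : (Fin m → ℝ) → ℝ} (hf : IsSemialgebraicFunOn k s f) :
    ∃ Z : Set (Fin m → ℝ), Z ⊆ s ∧ IsSemialgebraic k Z ∧ interior Z = ∅ ∧ IsOpen (s \ Z) ∧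
      AnalyticOnNhd ℝ f (s \ Z) := by
  -- adapted from `Literature.NumberTheory.Transcendental.IsSemialgebraicFunOn.exists_contDiffOn_holds`
  classical
  obtain ⟨Q₀, hQ₀, hvan⟩ := hf.exists_finset_forall_exists_aeval_cons_eq_zero
  -- a uniform bound on the `y`-degrees
  set N : ℕ := Q₀.sup fun q => (finSuccEquiv k m q).natDegree with hN
  have hNq : ∀ q ∈ Q₀, (finSuccEquiv k m q).natDegree ≤ N := fun q hq =>
    Finset.le_sup (f := fun q => (finSuccEquiv k m q).natDegree) hq
  -- the pieces and their index set
  set M : MvPolynomial (Fin (m + 1)) k × Fin (N + 1) × (Fin (N + 1) → SignType) →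
      Set (Fin m → ℝ) := fun i =>
    {x | x ∈ s ∧
      (aeval x ((finSuccEquiv k m i.1).coeff i.2.1) ≠ 0 ∧
          ∀ j : Fin (N + 1), (i.2.1 : ℕ) < j → aeval x ((finSuccEquiv k m i.1).coeff j) = 0) ∧
        ∀ j : Fin (N + 1), SignType.sign (aeval (Fin.cons (f x) x : Fin (m + 1) → ℝ)
          ((finSuccEquiv k m).symm (derivative^[(j : ℕ)] (finSuccEquiv k m i.1)))) = i.2.2 j}
    with hM
  set I : Finset (MvPolynomial (Fin (m + 1)) k × Fin (N + 1) × (Fin (N + 1) → SignType)) :=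
    Q₀ ×ˢ ((Finset.univ : Finset (Fin (N + 1))) ×ˢ
      (Finset.univ.filter fun τ : Fin (N + 1) → SignType => τ 0 = 0)) with hI
  have hMs : ∀ i, M i ⊆ s := fun i x hx => hx.1
  have hMsa : ∀ i, IsSemialgebraic k (M i) := fun i =>
    hf.isSemialgebraic_piece i.1 N i.2.1 i.2.2
  have hGs : (⋃ i ∈ I, interior (M i)) ⊆ s :=
    iUnion₂_subset fun i _ => interior_subset.trans (hMs i)
  refine ⟨s \ ⋃ i ∈ I, interior (M i), Set.sdiff_subset, ?_, ?_, ?_, ?_⟩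
  · -- `Z` is semialgebraic
    exact (IsSemialgebraicFunOn.isSemialgebraic_holds hf).diff
      (IsSemialgebraic.biUnion I (fun i => interior (M i))
        fun i _ => isSemialgebraic_interior (hMsa i))
  · -- `Z` has empty interior: it is covered by finitely many closed sets with empty interior
    -- (a) the proper algebraic sets `W q = {x | q(x, ·) = 0}`
    have hW : ∀ q ∈ Q₀,
        IsClosed {x : Fin m → ℝ | ∀ i ≤ N, aeval x ((finSuccEquiv k m q).coeff i) = 0} ∧
        interior {x : Fin m → ℝ | ∀ i ≤ N, aeval x ((finSuccEquiv k m q).coeff i) = 0} = ∅ := by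
      intro q hq
      obtain ⟨w, hw⟩ := hQ₀ q hq
      have hPw : (finSuccEquiv k m q).map (MvPolynomial.eval₂Hom (algebraMap k ℝ) (Fin.tail w)) ≠
          0 := by
        intro h0
        apply hw
        rw [← Fin.cons_self_tail w, aeval_cons_eq_eval_map, h0, Polynomial.eval_zero]
      obtain ⟨i₀, hi₀, hne⟩ : ∃ i ≤ N, aeval (Fin.tail w) ((finSuccEquiv k m q).coeff i) ≠ 0 := by
        by_contra hall
        push Not at hall
        exact hPw ((map_finSuccEquiv_eq_zero_iff q _ (hNq q hq)).mpr hall)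
      have hrepr : {x : Fin m → ℝ | ∀ i ≤ N, aeval x ((finSuccEquiv k m q).coeff i) = 0} =
          ⋂ i ∈ Finset.range (N + 1),
            {x : Fin m → ℝ | aeval x ((finSuccEquiv k m q).coeff i) = 0} := by
        ext x
        simp only [mem_setOf_eq, mem_iInter, Finset.mem_range, Nat.lt_succ_iff]
      refine ⟨?_, ?_⟩
      · rw [hrepr]
        exact isClosed_biInter fun i _ => isClosed_setOf_aeval_eq_zero _
      · refine subset_empty_iff.mp ((interior_mono fun x hx => ?_).trans
          (interior_setOf_aeval_eq_zero ((finSuccEquiv k m q).coeff i₀) ⟨_, hne⟩).subset)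
        exact hx i₀ hi₀
    have hF₁c : IsClosed (⋃ q ∈ Q₀,
        {x : Fin m → ℝ | ∀ i ≤ N, aeval x ((finSuccEquiv k m q).coeff i) = 0}) :=
      isClosed_biUnion_finset fun q hq => (hW q hq).1
    have hF₁i : interior (⋃ q ∈ Q₀,
        {x : Fin m → ℝ | ∀ i ≤ N, aeval x ((finSuccEquiv k m q).coeff i) = 0}) = ∅ :=
      interior_biUnion_finset_eq_empty Q₀ _ (fun q hq => (hW q hq).1) fun q hq => (hW q hq).2
    -- (b) the nowhere dense sets `M i \ interior (M i)`
    have hF₂i : interior (⋃ i ∈ I, closure (M i \ interior (M i))) = ∅ :=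
      interior_biUnion_finset_eq_empty I _ (fun i _ => isClosed_closure) fun i _ =>
        (isSemialgebraic_diff_interior (hMsa i)).1.interior_closure_eq_empty
          (isSemialgebraic_diff_interior (hMsa i)).2
    -- the cover
    have hcover : s \ (⋃ i ∈ I, interior (M i)) ⊆
        (⋃ q ∈ Q₀, {x : Fin m → ℝ | ∀ i ≤ N, aeval x ((finSuccEquiv k m q).coeff i) = 0}) ∪
          ⋃ i ∈ I, closure (M i \ interior (M i)) := by
      rintro x ⟨hxs, hxG⟩
      obtain ⟨q, hq, hq0⟩ := hvan x hxs
      by_cases hPx : (finSuccEquiv k m q).map (MvPolynomial.eval₂Hom (algebraMap k ℝ) x) = 0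
      · exact Or.inl (mem_iUnion₂.mpr
          ⟨q, hq, (map_finSuccEquiv_eq_zero_iff q x (hNq q hq)).mp hPx⟩)
      · right
        set Px := (finSuccEquiv k m q).map (MvPolynomial.eval₂Hom (algebraMap k ℝ) x) with hPx'
        have heN : Px.natDegree < N + 1 :=
          Nat.lt_succ_of_le (natDegree_map_le.trans (hNq q hq))
        set e : Fin (N + 1) := ⟨Px.natDegree, heN⟩ with he
        set τ : Fin (N + 1) → SignType := fun j => SignType.sign
          (aeval (Fin.cons (f x) x : Fin (m + 1) → ℝ)
            ((finSuccEquiv k m).symm (derivative^[(j : ℕ)] (finSuccEquiv k m q)))) with hτ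
        have hτ0 : τ 0 = 0 := by
          simp [hτ, hq0]
        have hiI : (q, e, τ) ∈ I := by
          simp [hI, hq, hτ0]
        have hxM : x ∈ M (q, e, τ) := by
          refine ⟨hxs, ⟨?_, fun j hj => ?_⟩, fun j => rfl⟩
          · rw [← coeff_map_finSuccEquiv]
            exact leadingCoeff_ne_zero.mpr hPx
          · rw [← coeff_map_finSuccEquiv]
            exact coeff_eq_zero_of_natDegree_lt hj
        have hxnot : x ∉ interior (M (q, e, τ)) := fun h =>
          hxG (mem_iUnion₂.mpr ⟨(q, e, τ), hiI, h⟩)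
        exact mem_iUnion₂.mpr ⟨(q, e, τ), hiI, subset_closure ⟨hxM, hxnot⟩⟩
    have hunion : interior
        ((⋃ q ∈ Q₀, {x : Fin m → ℝ | ∀ i ≤ N, aeval x ((finSuccEquiv k m q).coeff i) = 0}) ∪
          ⋃ i ∈ I, closure (M i \ interior (M i))) = ∅ := by
      rw [interior_union_isClosed_of_interior_empty hF₁c hF₂i, hF₁i]
    exact subset_empty_iff.mp ((interior_mono hcover).trans hunion.subset)
  · -- `s \ Z` is open
    rw [Set.sdiff_sdiff_cancel_left hGs]
    exact isOpen_biUnion fun i _ => isOpen_interior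
  · -- `f` is analytic on `s \ Z`
    rw [Set.sdiff_sdiff_cancel_left hGs]
    intro x hx
    obtain ⟨i, hi, hxi⟩ := mem_iUnion₂.mp hx
    have hi' : i.1 ∈ Q₀ ∧ i.2.2 0 = 0 := by
      simpa [hI] using hi
    exact analyticAt_of_mem_interior_piece i.1 (hNq i.1 hi'.1) i.2.1 hi'.2
      (interior_mono (fun y hy => hy.2) hxi)

/-! ## The registered stub -/

/-- **A — generic analyticity of `ℚ`-semialgebraic functions.** A function with `ℚ`-semialgebraic
graph over an open `s ⊆ ℝᵐ` is real analytic off a `ℚ`-semialgebraic subset `Z ⊆ s` with empty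
interior and `s \ Z` open (the tree's `IsSemialgebraicFunOn.exists_contDiffOn_holds` with `∞`
replaced by `ω`: Thom sign pieces, continuity on their interiors, and the ANALYTIC implicit
function theorem at a simple root of a `y`-derivative; the case `k = ℚ` of
`exists_analyticOnNhd_of_isSemialgebraicFunOn`, the openness of `s` being unused).
[cite: BochnakCosteRoy1998, Prop. 8.1.8 and Prop. 2.9.10] -/
theorem stub_saAnalyticOffSmall : ∀ {m : ℕ} {s : Set (Fin m → ℝ)} {f : (Fin m → ℝ) → ℝ},
    IsOpen s → IsSemialgebraicFunOn ℚ s f →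
    ∃ Z : Set (Fin m → ℝ), Z ⊆ s ∧ IsSemialgebraic ℚ Z ∧ interior Z = ∅ ∧ IsOpen (s \ Z) ∧
      AnalyticOnNhd ℝ f (s \ Z) :=
  fun _ hf => exists_analyticOnNhd_of_isSemialgebraicFunOn hf

end Summit.KontsevichZagierPeriods.FurushoPentagon.SectorToKernel
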